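import Literature.NumberTheory.GaloisRepresentations.ContinuousCohomologyConnectingNaturality
import Literature.NumberTheory.EllipticCurves.ZpExtensionEisensteinSelmerStructure
import HarnessLib

/-!
# Kummer classes are components of TORSION compatible families (naturality of `δ₀` along a tower)

Topic `NumberTheory/GaloisRepresentations` (sequel to `ContinuousCohomologyConnecting` (`IsSES.δ₀`) and
`ContinuousCohomologyConnectingNaturality` (`IsSES.cohomologyMap_δ₀`), in the currency of the abstract towers
`Literature.NumberTheory.EllipticCurves.Tower.*` of `ZpExtensionEisensteinSelmerStructure` §1).
One theorem; no definition, no named fact, no instance, no `sorry`.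

* **Kummer lift along a tower** (`mem_levelCondition_bot_of_cohomologyMap_eq_zero`): given short exact sequences
  `0 → W_n —ι_n→ W'_n —q_n→ E → 0` (`n ∈ ℕ`, one fixed `E` killed by `p^a`) compatible with reductions
  `r_n : W_{n+1} → W_n`, `r'_n : W'_{n+1} → W'_n` (`r' ∘ ι = ι ∘ r`, `q ∘ r' = q`), every class `z ∈ H¹(Γ, W_k)` KILLED
  BY `H¹(ι_k)` is the `k`-th component of a `p^a`-torsion compatible family of `(H¹(Γ, W_n), H¹(r_n))_n`, namely
  `(δ₀^{(n)} v)_n` for `z = δ₀^{(k)} v` — i.e. `z ∈ Tower.levelCondition red p ⊥ k`, the BOTTOM level condition.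
  For the `p`-adic tower of a finitely generated `ℤ_p`-lattice `T` (`W_n = T/p^n`, `W'_n = T/p^{n+a}`, `E = T/p^a`,
  `ι =` multiplication by `p^a`) this says: the Kummer classes `ker (H¹(K_v, T/p^k) → H¹(K_v, T/p^{k+a}))`
  `= δ(H⁰(K_v, T/p^a))` are the level-`k` components of torsion elements of `H¹(K_v, T) = lim_n H¹(K_v, T/p^n)` —
  the half «`A_k ⊆ π_k(H¹(K_v,T)_tors)`» of the input (Dual) of `Tower.mem_levelCondition_of_forall_pairing_eq_zero`
  (`EllipticCurves/TowerSaturatedAnnihilatorProofs`, Howard 2004 H.4 for the saturated conditions).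

BSD is not proved by any of this.

References: [SerreGaloisCohomology1997] J.-P. Serre, *Galois Cohomology* (1997), I §2.2 (the exact sequence of
cohomology), I §2.3; [NeukirchSchmidtWingberg2008] (1.3.2), (2.7.x) (Kummer sequences in towers);
[Howard2004HeegnerKolyvagin] B. Howard, Compositio Math. 140 (2004), Def. 2.1.1 / §1.3 H.4 (arXiv:1202.6340 pp. 5–7).
-/

noncomputable section

open CategoryTheory Function

universe u

namespace Literature.NumberTheory.GaloisRepresentations

open _root_.TopRep _root_.ContinuousCohomology

/-! ## Kummer classes lift to torsion compatible families -/

section Tower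

open Literature.NumberTheory.EllipticCurves

variable {Γ : Type u} [Group Γ] [TopologicalSpace Γ] [IsTopologicalGroup Γ]
variable {W : ℕ → Type u} [∀ n, AddCommGroup (W n)] [∀ n, TopologicalSpace (W n)] [∀ n, DiscreteTopology (W n)]
variable {W' : ℕ → Type u} [∀ n, AddCommGroup (W' n)] [∀ n, TopologicalSpace (W' n)] [∀ n, DiscreteTopology (W' n)]
variable {E : Type u} [AddCommGroup E] [TopologicalSpace E] [DiscreteTopology E]
variable {ρ : ∀ n, ContinuousRep Γ ℤ (W n)} {ρ' : ∀ n, ContinuousRep Γ ℤ (W' n)} {ρE : ContinuousRep Γ ℤ E}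
variable {ι : ∀ n, (ρ n).toTopRep ⟶ (ρ' n).toTopRep} {q : ∀ n, (ρ' n).toTopRep ⟶ ρE.toTopRep}

/-- **Kummer classes are components of torsion compatible families.**  Let `0 → W_n —ι_n→ W'_n —q_n→ E → 0`
(`n ∈ ℕ`) be short exact sequences of discrete `Γ`-modules onto one FIXED `E` killed by `p^a`, compatible with
reductions `r_n : W_{n+1} → W_n`, `r'_n : W'_{n+1} → W'_n` (`r'_n ι_{n+1} = ι_n r_n`, `q_n r'_n = q_{n+1}`), and let
`red_n = H¹(r_n)`.  If `z ∈ H¹(Γ, W_k)` dies under `H¹(ι_k)`, then `z = δ₀^{(k)} v` for some `v ∈ E^Γ` and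
`(δ₀^{(n)} v)_n` is a `p^a`-torsion compatible family through `z`: `z ∈ Tower.levelCondition red p ⊥ k`.  (For
`W_n = T/p^n`, `W'_n = T/p^{n+a}`, `ι = p^a`: the Kummer classes `δ(H⁰(T/p^a)) ⊆ H¹(T/p^k)` are the level-`k`
components of torsion elements of `lim_n H¹(T/p^n)`.) [cite: SerreGaloisCohomology1997, I §2.2–2.3]
[cite: Howard2004HeegnerKolyvagin, Def. 2.1.1 and §1.3 H.4 (arXiv pp. 5–7)] -/
theorem mem_levelCondition_bot_of_cohomologyMap_eq_zero (hS : ∀ n, IsSES (ι n) (q n))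
    (r : ∀ n, (ρ (n + 1)).toTopRep ⟶ (ρ n).toTopRep) (r' : ∀ n, (ρ' (n + 1)).toTopRep ⟶ (ρ' n).toTopRep)
    (hιr : ∀ n (x : W (n + 1)), (r' n).hom ((ι (n + 1)).hom x) = (ι n).hom ((r n).hom x))
    (hqr : ∀ n (y : W' (n + 1)), (q n).hom ((r' n).hom y) = (q (n + 1)).hom y)
    (red : ∀ n, (continuousCohomology 1 (ρ (n + 1)).toTopRep : Type u) →+ (continuousCohomology 1 (ρ n).toTopRep : Type u))
    (hred : ∀ n (x : continuousCohomology 1 (ρ (n + 1)).toTopRep), red n x = cohomologyMap (r n) 1 x)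
    {p a : ℕ} (hE : ∀ e : E, p ^ a • e = 0) (k : ℕ) (z : continuousCohomology 1 (ρ k).toTopRep)
    (hz : cohomologyMap (ι k) 1 z = 0) :
    z ∈ Tower.levelCondition red p (fun n => (⊥ : AddSubgroup (continuousCohomology 1 (ρ n).toTopRep))) k := by
  obtain ⟨v, hv⟩ := (hS k).exists_δ₀_eq_of_map_one_eq_zero z hz
  rw [Tower.mem_levelCondition_iff]
  refine ⟨fun n => (hS n).δ₀ v, (Tower.mem_saturatedFamilies_iff _ _ _ _).2 ⟨fun n => ?_, a, fun n => ?_⟩, hv⟩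
  · -- compatibility: naturality of `δ₀` along `(r_n, r'_n, 𝟙_E)`
    rw [hred, (hS (n + 1)).cohomologyMap_δ₀ (hS n) (φ₁ := r n) (φ₂ := r' n) (φ₃ := 𝟙 _) (hιr n)
      (fun y => (hqr n y).symm) v]
    rfl
  · -- torsion: `p^a • δ₀ v = δ₀ (p^a • v) = 0`
    rw [AddSubgroup.mem_bot, ← map_nsmul]
    have : p ^ a • v = 0 := Subtype.ext (hE (v : E))
    rw [this, map_zero]

end Tower

end Literature.NumberTheory.GaloisRepresentations
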